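import Literature.AlgebraicGeometry.AbelianSchemes.MumfordDualArtinianTowerAnyChar
import Literature.AlgebraicGeometry.AbelianSchemes.SeesawSheafIffGraphCondRelative
import Literature.AlgebraicGeometry.AbelianSchemes.AbelianSchemeSeesawSubschemeAffineBase
import Literature.AlgebraicGeometry.AbelianSchemes.ClassifyOfAffineFiniteTypeOfNoetherian
import Literature.AlgebraicGeometry.Morphisms.ClosedImmersionOfProperUnramifiedInjective
import Literature.AlgebraicGeometry.Morphisms.ClosedImmersionIsoOfThickenings
import Literature.AlgebraicGeometry.Modules.DetClassTensor
import Literature.AlgebraicGeometry.Modules.DetClassDual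
import HarnessLib

/-!
# Mumford's dual `(A′⁄K(L′), 𝒫′)` is UNIVERSAL over all `T → S′`, in ANY characteristic ([MumfordAV1970] §13) — the (Mc) N3′ head and closer OFF `ℚ`

Layer `Literature/AlgebraicGeometry/AbelianSchemes`, namespace `Literature.AlgebraicGeometry.AbelianSchemes.MumfordDual`.  THEOREMS ONLY (no definition,
no named fact, no instance, no notation, no `sorry`).  Cell `hodgecm-mathlib` (D-0151), P6 «MOD programme», L4 DUALS road (LEAD «M-55c»; LA4-p05 (g0)), road (A)
re-thread files **O3b = N3′ head** + **O3c = (Mc)** (★ `Theorems/F3DualAbelianSchemeMcStubN3` ∕ `…MStubMc` OFF `ℚ`): the Summits proofs re-run VERBATIM over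
ANY Noetherian affine base over the any-characteristic tower ★ `MumfordDualArtinianTowerAnyChar` and the ★ letters N1′ `exists_seesawSubscheme_of_isAffine`, N2a′
`seesawSheaf_iff_graphCond`, N3d′ `formallyUnramified_fst_of_graph`, W1 `isClosedImmersion_of_forall_injective_geometricPoints`, N0′
`existsUnique_classify_of_affine_finiteType_of_isAffine` (none of which ever used `ℚ`).

* §1 **`factor_infinitesimalNbhd_of_graph`** (N3′): every infinitesimal neighbourhood `Spec 𝒪_{T′,t}⁄𝔪^{n+1} → T′` of an affine finite-type `T′ → S′` factors
  through the seesaw graph `Γ ↪ T′ × Â′`; §2 private wrappers of the four ★ letters; §3 **`existsUnique_classify_affineFiniteType`** ([MumfordAV1970] §13, «mono,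
  not étale»: `Γ → T′` proper + formally unramified + injective on geometric points ⇒ closed immersion ⇒ isomorphism); §4 **`existsUnique_classify`** — THE (Mc)
  HEAD: for every `T → S′` and rigidified fibrewise-`Pic⁰` `ℒ` on `A′_T` a UNIQUE `g : T → Â′` with `(1 × g)^*𝒫′ ≅ ℒ` (the `universal` field of ★ `DualPair`).
Sequel: `MumfordDualOfConnectedAffineAnyChar` ((M)).  HC_CM is proved only modulo the printed citations (2 remaining named inputs hLiu418 24832, h413 24833)
until rung 0 closes; nothing here is about HC.

## References
* [MumfordAV1970] D. Mumford, *Abelian Varieties* (1970), §13 (Thm. p. 125, proof pp. 125–130), §10 (p. 89), §8 (p. 77); [MilneAV2008] I §8 (Thm. 8.9).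
* [MumfordFogartyKirwan1994] *GIT* 3rd ed., Ch. 6 §2 (p. 121); [GortzWedhorn2023] Thm. 24.66, (27.41.1), Def. 27.216; [GortzWedhorn2020] (6.4) Prop. 6.7.
* [EGAIV4] Prop. 17.2.6, Cor. 18.12.6; [StacksProject] Tag 04XV; [Hartshorne1977] Ch. II Prop. 5.9 (p. 116).
-/

noncomputable section

open CategoryTheory CategoryTheory.Limits AlgebraicGeometry MonoidalCategory CartesianMonoidalCategory
open scoped MonObj
open Literature.AlgebraicGeometry Literature.AlgebraicGeometry.AbelianSchemes Literature.AlgebraicGeometry.RelativeSpec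
open Literature.AlgebraicGeometry.Motives Literature.AlgebraicGeometry.AbelianVarieties Literature.AlgebraicGeometry.Modules
open Literature.AlgebraicGeometry.Deformation

namespace Literature.AlgebraicGeometry.AbelianSchemes

namespace MumfordDual

/-- `R/𝔪ⁿ⁺¹` is Artinian for a Noetherian local `(R, 𝔪)`. [cite: StacksProject, Tag 00J8] -/
private theorem isArtinianRing_quotient_maximalIdeal_pow'' {R₀ : Type} [CommRing R₀] [IsNoetherianRing R₀] [IsLocalRing R₀] (n : ℕ) :
    IsArtinianRing (R₀ ⧸ IsLocalRing.maximalIdeal R₀ ^ (n + 1)) := by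
  apply IsLocalRing.quotient_artinian_of_mem_minimalPrimes_of_isLocalRing
  refine ⟨⟨inferInstance, Ideal.pow_le_self (Nat.succ_ne_zero n)⟩, ?_⟩
  rintro q ⟨hq, hle⟩ -
  haveI := hq
  exact (Ideal.IsPrime.pow_le_iff (I := IsLocalRing.maximalIdeal R₀) (P := q) (Nat.succ_ne_zero n)).mp hle

/-- `R/𝔪ⁿ⁺¹` is local. [cite: StacksProject, Tag 00J8] -/
private theorem isLocalRing_quotient_maximalIdeal_pow'' {R₀ : Type} [CommRing R₀] [IsLocalRing R₀] (n : ℕ) :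
    IsLocalRing (R₀ ⧸ IsLocalRing.maximalIdeal R₀ ^ (n + 1)) := by
  have hne : IsLocalRing.maximalIdeal R₀ ^ (n + 1) ≠ ⊤ := fun h =>
    (IsLocalRing.maximalIdeal.isMaximal R₀).ne_top
      (top_le_iff.mp (h ▸ Ideal.pow_le_self (Nat.succ_ne_zero n)))
  haveI : Nontrivial (R₀ ⧸ IsLocalRing.maximalIdeal R₀ ^ (n + 1)) := Ideal.Quotient.nontrivial_iff.mpr hne
  exact IsLocalRing.of_surjective' (Ideal.Quotient.mk _) Ideal.Quotient.mk_surjective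

/-! ## §1 (N3′) every infinitesimal neighbourhood factors through the seesaw graph -/

/-- **(N3′) `stub_McN3` PROVED from the inner stubs S-a/S-b/S-e (S-d inside S-e), S-f and the sibling N2b′** — the statement is the
(Mc) line's `stub_McN3` (v2.1c :367) VERBATIM with `[Algebra ℚ R]` removed: for every point `t` of the affine finite-type `T′ → S′` and every `n`, the infinitesimal
neighbourhood `Spec 𝒪_{T′,t}⁄𝔪^{n+1} → T′` factors through the seesaw graph `Γ`.  Proof: `T′` is locally Noetherian (finite type over the
finite étale `S′` over the Noetherian `R`), so `𝒪_{T′,t}⁄𝔪^{n+1}` is Artinian local; the any-characteristic tower (G3) ★ `MumfordDual.graphPoint_tower`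
(no injectivity hypothesis, no `CharZero κ(t)`) at `K := 𝔪^{n+1}`, `ψ := mk` gives a graph point `y`, and the graph's functor of points `hΓ` at the
test object `Spec 𝒪_{T′,t}⁄𝔪^{n+1} → S′` turns `(x, y)` into the factorisation. [cite: MumfordAV1970, §13 (Thm. p. 125 and its proof, pp. 125–130)]
[cite: Hartshorne1977, Ch. II, Prop. 5.9 (p. 116)] -/
theorem factor_infinitesimalNbhd_of_graph : ∀ (R : Type) [CommRing R] [IsNoetherianRing R] (A : AbelianSchemeOver (Spec (.of R)))
    (L : A.left.Modules) (hL : HasRank L 1)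
    (_hε : CechPic.pullback A.unitSection (detClass (HasRank.isFiniteLocallyFree' hL)) = 1)
    (_hΘ : ∀ ⦃Ω : Type⦄ [Field Ω] [IsAlgClosed Ω] (s : Spec (.of Ω) ⟶ Spec (.of R)),
      ∃ Θ : CartierDivisor (A.fibre s).toAbelianVariety.X.left, Θ.IsAmple ∧
        CechPic.pullback (X := (A.fibre s).toAbelianVariety.X.left) (pullback.fst A.X.hom s)
          (detClass (HasRank.isFiniteLocallyFree' hL)) = Θ.cechClass)
    {S' : Scheme.{0}} [IsAffine S'] (p : S' ⟶ Spec (.of R)) [IsFinite p] [Etale p] [Surjective p]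
    (hH1 : ∀ (K₁ : Type) [Field K₁] (s : Spec (.of K₁) ⟶ S') {J : Type} [Finite J]
      (U : J → ((A.baseChange p).X ⊗ Over.mk s).left.Opens), (∀ i, IsAffineOpen (U i)) → iSup U = ⊤ →
      Module.Finite K₁ (Literature.AlgebraicGeometry.Morphisms.CechH1 (X := ((A.baseChange p).X ⊗ Over.mk s).left)
        (Limits.pullback.snd (A.baseChange p).X.hom s) U) ∧
        Module.finrank K₁ (Literature.AlgebraicGeometry.Morphisms.CechH1 (X := ((A.baseChange p).X ⊗ Over.mk s).left)
          (Limits.pullback.snd (A.baseChange p).X.hom s) U) = ((A.baseChange p).fibre s).toAbelianVariety.dim)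
    (hat : AbelianSchemeOver S') (π : (A.baseChange p).X ⟶ hat.X) [IsMonHom π]
    (_hπ : IsFinite π.left ∧ Etale π.left ∧ Surjective π.left)
    (P : ((A.baseChange p).prodLeft hat).Modules)
    (_hker : ∀ (T : Over S') (u : T ⟶ (A.baseChange p).X),
      u ≫ π = 1 ↔ (A.baseChange p).MemKOfL ((Scheme.Modules.pullback (pullback.fst A.X.hom p)).obj L) u)
    (_h1 : HasRank P 1)
    (_hrig : Nonempty ((Scheme.Modules.pullback ((A.baseChange p).unitSlice hat)).obj P ≅ SheafOfModules.unit _))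
    (_hsock : Nonempty ((Scheme.Modules.pullback ((A.baseChange p).X ◁ π).left).obj P ≅
      (A.baseChange p).mumfordBundle ((Scheme.Modules.pullback (pullback.fst A.X.hom p)).obj L)))
    (T' : Over S') [IsAffine T'.left] [LocallyOfFiniteType T'.hom]
    (ℒ : (A.baseChange p).RigidifiedLineBundle T'.hom) (_hℒ : ℒ.FibrewisePicZero)
    (Γ : Over S') (i : Γ ⟶ T' ⊗ hat.X) [IsClosedImmersion i.left],
    (∀ (S : Over S') (u : S ⟶ T' ⊗ hat.X), (∃ v : S ⟶ Γ, v ≫ i = u) ↔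
      Nonempty ((Scheme.Modules.pullback ((A.baseChange p).baseChangeToProd hat S.hom
          (u ≫ CartesianMonoidalCategory.snd T' hat.X).left (Over.w (u ≫ CartesianMonoidalCategory.snd T' hat.X)))).obj P ≅
        (Scheme.Modules.pullback ((A.baseChange p).X ◁ (u ≫ CartesianMonoidalCategory.fst T' hat.X)).left).obj ℒ.L)) →
    ∀ (t : T'.left) (n : ℕ),
      ∃ g : Spec (.of (↑(T'.left.presheaf.stalk t) ⧸
          IsLocalRing.maximalIdeal ↑(T'.left.presheaf.stalk t) ^ (n + 1))) ⟶ Γ.left,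
        g ≫ (i ≫ CartesianMonoidalCategory.fst T' hat.X).left =
          Spec.map (CommRingCat.ofHom (Ideal.Quotient.mk
            (IsLocalRing.maximalIdeal ↑(T'.left.presheaf.stalk t) ^ (n + 1)))) ≫ T'.left.fromSpecStalk t := by
  intro R _ _ A L hL hε hΘ S' _ p _ _ _ hH1 hat π _ hπ P hker h1 hrig hsock T' _ _ ℒ hℒ Γ i _ hΓ t n
  classical
  -- `T′` is locally Noetherian
  haveI : IsLocallyNoetherian S' := LocallyOfFiniteType.isLocallyNoetherian p
  haveI : IsLocallyNoetherian T'.left := LocallyOfFiniteType.isLocallyNoetherian T'.hom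
  -- `O := 𝒪_{T′,t} ⁄ 𝔪^{n+1}` is Artinian local
  haveI := isArtinianRing_quotient_maximalIdeal_pow'' (R₀ := (T'.left.presheaf.stalk t : Type)) n
  haveI := isLocalRing_quotient_maximalIdeal_pow'' (R₀ := (T'.left.presheaf.stalk t : Type)) n
  -- the tower at `K := 𝔪^{n+1}`, `ψ := mk`
  obtain ⟨y, ⟨e⟩⟩ := graphPoint_tower R A L hL hε hΘ p hH1 hat π hπ P hker h1 hrig hsock T' ℒ hℒ t _
    (↑(T'.left.presheaf.stalk t) ⧸ IsLocalRing.maximalIdeal ↑(T'.left.presheaf.stalk t) ^ (n + 1))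
    (Ideal.Quotient.mk _) Ideal.Quotient.mk_surjective Ideal.mk_ker
    ((Spec.map (CommRingCat.ofHom (Ideal.Quotient.mk
        (IsLocalRing.maximalIdeal ↑(T'.left.presheaf.stalk t) ^ (n + 1)))) ≫ T'.left.fromSpecStalk t) ≫ T'.hom)
    (Over.homMk (Spec.map (CommRingCat.ofHom (Ideal.Quotient.mk
        (IsLocalRing.maximalIdeal ↑(T'.left.presheaf.stalk t) ^ (n + 1)))) ≫ T'.left.fromSpecStalk t) rfl) rfl
  -- the graph's functor of points at the test object `Spec O → S′`
  obtain ⟨v, hv⟩ := (hΓ (Over.mk _) (CartesianMonoidalCategory.lift (Over.homMk (Spec.map (CommRingCat.ofHom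
      (Ideal.Quotient.mk (IsLocalRing.maximalIdeal ↑(T'.left.presheaf.stalk t) ^ (n + 1)))) ≫
        T'.left.fromSpecStalk t) rfl) y)).mpr (by
    rw [CartesianMonoidalCategory.lift_snd, CartesianMonoidalCategory.lift_fst]
    exact ⟨e⟩)
  refine ⟨v.left, ?_⟩
  change (v ≫ i ≫ CartesianMonoidalCategory.fst T' hat.X).left = _
  rw [← Category.assoc, hv, CartesianMonoidalCategory.lift_fst]
  rfl

/-! ## §2 The (Mc) letters (N1′, N2a′, N3d′, W1) over their ★ closers, any characteristic (private wrappers) -/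

/-- (N1′) the relative SEESAW closed subscheme over the affine `S′` for a rank-one `𝓕` on `A′ × W`, `W → S′` locally of finite type —
BY NAME over ★ `AbelianSchemeOver.exists_seesawSubscheme_of_isAffine`. [cite: MumfordAV1970, §10 (p. 89)] [cite: GortzWedhorn2023, Thm. 24.66] -/
private theorem stub_McN1 : ∀ (R : Type) [CommRing R] [IsNoetherianRing R] (A : AbelianSchemeOver (Spec (.of R)))
    {S' : Scheme.{0}} [IsAffine S'] (p : S' ⟶ Spec (.of R)) [IsFinite p] [Etale p]
    (W : Over S') [LocallyOfFiniteType W.hom] (𝓕 : ((A.baseChange p).X ⊗ W).left.Modules), HasRank 𝓕 1 →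
    ∃ (Z : Over S') (i : Z ⟶ W) (_ : IsClosedImmersion i.left),
      ∀ (S : Over S') (u : S ⟶ W),
        (∃ v : S ⟶ Z, v ≫ i = u) ↔
          ∃ (𝓜 : S.left.Modules) (_ : HasRank 𝓜 1),
            Nonempty ((Scheme.Modules.pullback ((A.baseChange p).X ◁ u).left).obj 𝓕 ≅
              (Scheme.Modules.pullback (CartesianMonoidalCategory.snd (A.baseChange p).X S).left).obj 𝓜) := by
  -- (N1′) DISCHARGED BY NAME (v2.1): ★ p792841 `AbelianSchemes/AbelianSchemeSeesawSubschemeAffineBase` (B-p12 (g18) ∕ F0P1c-p05 (g0))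
  intro R _ _ A S' _ p _ _ W _ 𝓕 h𝓕
  haveI : IsLocallyNoetherian S' := LocallyOfFiniteType.isLocallyNoetherian p
  exact (A.baseChange p).exists_seesawSubscheme_of_isAffine W 𝓕 h𝓕

/-- (N2a′) «rigidifications kill the twist»: base-triviality of the seesaw sheaf ⟺ the graph condition — BY NAME over ★
`AbelianSchemeOver.seesawSheaf_iff_graphCond`. [cite: MumfordAV1970, §13 (proof of the Thm. p. 125)] [cite: MilneAV2008, I §8 (pp. 36–37)] -/
private theorem stub_McN2a : ∀ (R : Type) [CommRing R] [IsNoetherianRing R] (A : AbelianSchemeOver (Spec (.of R)))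
    {S' : Scheme.{0}} [IsAffine S'] (p : S' ⟶ Spec (.of R)) [IsFinite p] [Etale p]
    (hat : AbelianSchemeOver S') (P : ((A.baseChange p).prodLeft hat).Modules) (_h1 : HasRank P 1)
    (_hrig : Nonempty ((Scheme.Modules.pullback ((A.baseChange p).unitSlice hat)).obj P ≅ SheafOfModules.unit _))
    (T' : Over S') (ℒ : (A.baseChange p).RigidifiedLineBundle T'.hom)
    (S : Over S') (u : S ⟶ T' ⊗ hat.X),
    (∃ (𝓜 : S.left.Modules) (_ : HasRank 𝓜 1),
      Nonempty ((Scheme.Modules.pullback ((A.baseChange p).X ◁ u).left).obj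
        (tensorObj
          ((Scheme.Modules.pullback ((A.baseChange p).X ◁ CartesianMonoidalCategory.fst T' hat.X).left).obj ℒ.L)
          (Literature.AlgebraicGeometry.Modules.dual ((Scheme.Modules.pullback ((A.baseChange p).X ◁ CartesianMonoidalCategory.snd T' hat.X).left).obj P))) ≅
        (Scheme.Modules.pullback (CartesianMonoidalCategory.snd (A.baseChange p).X S).left).obj 𝓜)) ↔
    Nonempty ((Scheme.Modules.pullback ((A.baseChange p).baseChangeToProd hat S.hom
        (u ≫ CartesianMonoidalCategory.snd T' hat.X).left (Over.w (u ≫ CartesianMonoidalCategory.snd T' hat.X)))).obj P ≅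
      (Scheme.Modules.pullback ((A.baseChange p).X ◁ (u ≫ CartesianMonoidalCategory.fst T' hat.X)).left).obj ℒ.L) :=
  -- (N2a′) DISCHARGED BY NAME (v2): ★ p788539 `AbelianSchemeOver.seesawSheaf_iff_graphCond`, closer body of B-p08 (g15) J2 e48e3c37
  fun _R _ _ A _S' _ p _ _ hat P h1 hrig _T' ℒ S u =>
    (A.baseChange p).seesawSheaf_iff_graphCond hat P ℒ h1 hrig S u

/-- (N3d′) the seesaw graph `Γ → T′` is FORMALLY UNRAMIFIED (first-order rigidity of `𝒫′` at every point) — over ★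
`AbelianSchemeOver.formallyUnramified_fst_of_graph`. [cite: MumfordAV1970, §13 (proof of the Thm., pp. 125–129)] [cite: GortzWedhorn2020, (6.4) Prop. 6.7] -/
private theorem stub_McN3d : ∀ (R : Type) [CommRing R] [IsNoetherianRing R] (A : AbelianSchemeOver (Spec (.of R)))
    (L : A.left.Modules) (hL : HasRank L 1)
    (_hε : CechPic.pullback A.unitSection (detClass (HasRank.isFiniteLocallyFree' hL)) = 1)
    {S' : Scheme.{0}} [IsAffine S'] (p : S' ⟶ Spec (.of R)) [IsFinite p] [Etale p]
    (hat : AbelianSchemeOver S') (π : (A.baseChange p).X ⟶ hat.X) [IsMonHom π]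
    (_hπ : IsFinite π.left ∧ Etale π.left ∧ Surjective π.left)
    (P : ((A.baseChange p).prodLeft hat).Modules)
    (_hker : ∀ (T : Over S') (u : T ⟶ (A.baseChange p).X),
      u ≫ π = 1 ↔ (A.baseChange p).MemKOfL ((Scheme.Modules.pullback (pullback.fst A.X.hom p)).obj L) u)
    (_h1 : HasRank P 1)
    (_hrig : Nonempty ((Scheme.Modules.pullback ((A.baseChange p).unitSlice hat)).obj P ≅ SheafOfModules.unit _))
    (_hsock : Nonempty ((Scheme.Modules.pullback ((A.baseChange p).X ◁ π).left).obj P ≅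
      (A.baseChange p).mumfordBundle ((Scheme.Modules.pullback (pullback.fst A.X.hom p)).obj L)))
    (T' : Over S') [LocallyOfFiniteType T'.hom] (ℒ : (A.baseChange p).RigidifiedLineBundle T'.hom) (_hℒ : ℒ.FibrewisePicZero)
    (Γ : Over S') (i : Γ ⟶ T' ⊗ hat.X) [IsClosedImmersion i.left],
    (∀ (S : Over S') (u : S ⟶ T' ⊗ hat.X), (∃ v : S ⟶ Γ, v ≫ i = u) ↔
      Nonempty ((Scheme.Modules.pullback ((A.baseChange p).baseChangeToProd hat S.hom
          (u ≫ CartesianMonoidalCategory.snd T' hat.X).left (Over.w (u ≫ CartesianMonoidalCategory.snd T' hat.X)))).obj P ≅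
        (Scheme.Modules.pullback ((A.baseChange p).X ◁ (u ≫ CartesianMonoidalCategory.fst T' hat.X)).left).obj ℒ.L)) →
    FormallyUnramified (i ≫ CartesianMonoidalCategory.fst T' hat.X).left := by
  -- (N3d′) over ★ p793807 `AbelianSchemes/PoincareFamilyGraphFormallyUnramified` (B-p02 (g17); ★ p791848 §4 + ★ p787816 inside)
  intro R _ _ A L hL hε S' _ p _ _ hat π _ hπ P hker _h1 _hrig hsock T' _ ℒ _hℒ Γ i _ hΓ
  haveI : IsLocallyNoetherian S' := LocallyOfFiniteType.isLocallyNoetherian p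
  haveI : Etale π.left := hπ.2.1
  haveI : Surjective π.left := hπ.2.2
  exact (A.baseChange p).formallyUnramified_fst_of_graph hat π (hasRank_pullback _ hL)
    (AbelianSchemeOver.cechPic_pullback_unitSection_baseChange_eq_one A p hL hε) hker P hsock T' ℒ Γ i hΓ

/-- (W1) locally of finite type + formally unramified + proper + injective on geometric points ⇒ CLOSED IMMERSION — BY NAME over ★
`Morphisms.isClosedImmersion_of_forall_injective_geometricPoints`. [cite: EGAIV4, Prop. 17.2.6 and Cor. 18.12.6] [cite: StacksProject, Tag 04XV] -/
private theorem socket_McW1 : ∀ {X Y : Scheme.{0}} (f : X ⟶ Y) [FormallyUnramified f] [IsProper f],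
    (∀ (Ω : Type) [Field Ω] [IsAlgClosed Ω] (x₁ x₂ : Spec (.of Ω) ⟶ X), x₁ ≫ f = x₂ ≫ f → x₁ = x₂) →
    IsClosedImmersion f := by
  -- (W1) DISCHARGED BY NAME (v2.1): ★ p792179 `Morphisms/ClosedImmersionOfProperUnramifiedInjective` (B-p03 (g20))
  exact fun f _ _ hinj => Literature.AlgebraicGeometry.Morphisms.isClosedImmersion_of_forall_injective_geometricPoints f hinj

/-! ## §3 THE COMPOSITION over an affine finite-type `T → S′` (★ `McClosure.stub_F3Mc_affineFiniteType_of` off `ℚ`) -/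

section Composition

variable (R : Type) [CommRing R] [IsNoetherianRing R] (A : AbelianSchemeOver (Spec (.of R)))
    (L : A.left.Modules) (hL : HasRank L 1)
    (hε : CechPic.pullback A.unitSection (detClass (HasRank.isFiniteLocallyFree' hL)) = 1)
    (hΘ : ∀ ⦃Ω : Type⦄ [Field Ω] [IsAlgClosed Ω] (s : Spec (.of Ω) ⟶ Spec (.of R)),
      ∃ Θ : CartierDivisor (A.fibre s).toAbelianVariety.X.left, Θ.IsAmple ∧
        CechPic.pullback (X := (A.fibre s).toAbelianVariety.X.left) (pullback.fst A.X.hom s)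
          (detClass (HasRank.isFiniteLocallyFree' hL)) = Θ.cechClass)
    {S' : Scheme.{0}} [IsAffine S'] (p : S' ⟶ Spec (.of R)) [IsFinite p] [Etale p] [Surjective p]
    (hH1 : ∀ (K₁ : Type) [Field K₁] (s : Spec (.of K₁) ⟶ S') {J : Type} [Finite J]
      (U : J → ((A.baseChange p).X ⊗ Over.mk s).left.Opens), (∀ i, IsAffineOpen (U i)) → iSup U = ⊤ →
      Module.Finite K₁ (Literature.AlgebraicGeometry.Morphisms.CechH1 (X := ((A.baseChange p).X ⊗ Over.mk s).left)
        (Limits.pullback.snd (A.baseChange p).X.hom s) U) ∧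
        Module.finrank K₁ (Literature.AlgebraicGeometry.Morphisms.CechH1 (X := ((A.baseChange p).X ⊗ Over.mk s).left)
          (Limits.pullback.snd (A.baseChange p).X.hom s) U) = ((A.baseChange p).fibre s).toAbelianVariety.dim)
    (hat : AbelianSchemeOver S') (π : (A.baseChange p).X ⟶ hat.X) [IsMonHom π]
    (hπ : IsFinite π.left ∧ Etale π.left ∧ Surjective π.left)
    (P : ((A.baseChange p).prodLeft hat).Modules)
    (hker : ∀ (T : Over S') (u : T ⟶ (A.baseChange p).X),
      u ≫ π = 1 ↔ (A.baseChange p).MemKOfL ((Scheme.Modules.pullback (pullback.fst A.X.hom p)).obj L) u)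
    (h1 : HasRank P 1)
    (hrig : Nonempty ((Scheme.Modules.pullback ((A.baseChange p).unitSlice hat)).obj P ≅ SheafOfModules.unit _))
    (hsock : Nonempty ((Scheme.Modules.pullback ((A.baseChange p).X ◁ π).left).obj P ≅
      (A.baseChange p).mumfordBundle ((Scheme.Modules.pullback (pullback.fst A.X.hom p)).obj L)))

include hε hΘ hH1 hπ hker h1 hrig hsock in
set_option backward.isDefEq.respectTransparency false in
/-- **ROAD M13 RELATIVE TO `S′`, OVER AN AFFINE FINITE-TYPE BASE** ([MumfordAV1970] §13 (proof of the Theorem p. 125) in the «mono, not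
étale» form; port of ★ `Residual.residual_affineFiniteType_of_M13`): the seesaw graph `Γ ↪ T × Â′ → T` (N1′ + N2a′) is proper (`Â′`
proper) and formally unramified (N3d′), injective on geometric points (N2b′) hence a CLOSED IMMERSION (W1), through which every
infinitesimal neighbourhood of every point factors (N3′), hence an ISOMORPHISM (★ `Morphisms.isIso_of_isClosedImmersion_of_forall_factor`,
all points); its inverse followed by `pr_{Â′}` is the unique classifying map. [cite: MumfordAV1970, §13 (Thm. p. 125 and its proof)]
[cite: Hartshorne1977, Ch. II, Prop. 5.9 (p. 116)] -/
theorem existsUnique_classify_affineFiniteType (T' : Over S') [IsAffine T'.left] [LocallyOfFiniteType T'.hom]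
    (ℒ : (A.baseChange p).RigidifiedLineBundle T'.hom) (hℒ : ℒ.FibrewisePicZero) :
    ∃! g : {g : T'.left ⟶ hat.X.left // g ≫ hat.X.hom = T'.hom},
      Nonempty ((Scheme.Modules.pullback ((A.baseChange p).baseChangeToProd hat T'.hom g.1 g.2)).obj P ≅ ℒ.L) := by
  -- `Â′` and the instances
  haveI := hat.isProper
  haveI := hat.isSmooth
  haveI : IsLocallyNoetherian S' := LocallyOfFiniteType.isLocallyNoetherian p
  haveI : IsLocallyNoetherian T'.left := LocallyOfFiniteType.isLocallyNoetherian T'.hom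
  -- the functor of points we represent = the graph condition, SPELLED OUT (D1); an opaque local name with its unfolding
  obtain ⟨GC, hGC⟩ : ∃ GC : ∀ (S : Over S') (_ : S ⟶ T' ⊗ hat.X), Prop, ∀ (S : Over S') (u : S ⟶ T' ⊗ hat.X), GC S u ↔
      Nonempty ((Scheme.Modules.pullback ((A.baseChange p).baseChangeToProd hat S.hom
          (u ≫ CartesianMonoidalCategory.snd T' hat.X).left (Over.w (u ≫ CartesianMonoidalCategory.snd T' hat.X)))).obj P ≅
        (Scheme.Modules.pullback ((A.baseChange p).X ◁ (u ≫ CartesianMonoidalCategory.fst T' hat.X)).left).obj ℒ.L) :=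
    ⟨_, fun _ _ => Iff.rfl⟩
  -- (N1′ + N2a′) the seesaw graph `Γ ↪ T × Â′` with `Γ(S) = {u ; GC u}`
  haveI : LocallyOfFiniteType (CartesianMonoidalCategory.fst T' hat.X).left :=
    inferInstanceAs (LocallyOfFiniteType (pullback.fst T'.hom hat.X.hom))
  haveI : LocallyOfFiniteType (T' ⊗ hat.X).hom := by
    rw [← Over.w (CartesianMonoidalCategory.fst T' hat.X)]
    infer_instance
  have h𝓕1 : HasRank (tensorObj
      ((Scheme.Modules.pullback ((A.baseChange p).X ◁ CartesianMonoidalCategory.fst T' hat.X).left).obj ℒ.L)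
      (Literature.AlgebraicGeometry.Modules.dual
        ((Scheme.Modules.pullback ((A.baseChange p).X ◁ CartesianMonoidalCategory.snd T' hat.X).left).obj P))) 1 :=
    hasRank_tensorObj_one (hasRank_pullback _ ℒ.hasRank_one) (hasRank_dual (hasRank_pullback _ h1))
  obtain ⟨Γ, i, hi, hZ⟩ := stub_McN1 R A p (T' ⊗ hat.X) _ h𝓕1
  haveI := hi
  have hΓ' : ∀ (S : Over S') (u : S ⟶ T' ⊗ hat.X), (∃ v : S ⟶ Γ, v ≫ i = u) ↔
      Nonempty ((Scheme.Modules.pullback ((A.baseChange p).baseChangeToProd hat S.hom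
          (u ≫ CartesianMonoidalCategory.snd T' hat.X).left (Over.w (u ≫ CartesianMonoidalCategory.snd T' hat.X)))).obj P ≅
        (Scheme.Modules.pullback ((A.baseChange p).X ◁ (u ≫ CartesianMonoidalCategory.fst T' hat.X)).left).obj ℒ.L) :=
    fun S u => (hZ S u).trans (stub_McN2a R A p hat P h1 hrig T' ℒ S u)
  have hΓ : ∀ (S : Over S') (u : S ⟶ T' ⊗ hat.X), (∃ v : S ⟶ Γ, v ≫ i = u) ↔ GC S u := fun S u =>
    (hΓ' S u).trans (hGC S u).symm
  -- instances along `q := i ≫ pr_T : Γ → T`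
  haveI : IsProper (CartesianMonoidalCategory.fst T' hat.X).left :=
    inferInstanceAs (IsProper (pullback.fst T'.hom hat.X.hom))
  haveI : IsProper (i ≫ CartesianMonoidalCategory.fst T' hat.X).left := by
    change IsProper (i.left ≫ (CartesianMonoidalCategory.fst T' hat.X).left)
    infer_instance
  haveI : LocallyOfFiniteType Γ.hom := by
    rw [← Over.w (i ≫ CartesianMonoidalCategory.fst T' hat.X)]
    infer_instance
  haveI : Mono i := (Over.forget _).mono_of_mono_map (inferInstanceAs (Mono i.left))
  -- (N3d′) formally unramified
  haveI : FormallyUnramified (i ≫ CartesianMonoidalCategory.fst T' hat.X).left :=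
    stub_McN3d R A L hL hε p hat π hπ P hker h1 hrig hsock T' ℒ hℒ Γ i hΓ'
  -- (N2b′) injective on geometric points, hence (W1) a closed immersion
  have hinj : ∀ (Ω : Type) [Field Ω] [IsAlgClosed Ω] (x₁ x₂ : Spec (.of Ω) ⟶ Γ.left),
      x₁ ≫ (i ≫ CartesianMonoidalCategory.fst T' hat.X).left = x₂ ≫ (i ≫ CartesianMonoidalCategory.fst T' hat.X).left →
        x₁ = x₂ := by
    intro Ω _ _ x₁ x₂ h12
    obtain ⟨s, hs₁⟩ : ∃ s : Spec (.of Ω) ⟶ S', x₁ ≫ Γ.hom = s := ⟨_, rfl⟩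
    have hs₂ : x₂ ≫ Γ.hom = s := by
      rw [← hs₁, ← Over.w (i ≫ CartesianMonoidalCategory.fst T' hat.X), ← Category.assoc, ← Category.assoc, h12]
    obtain ⟨o₁, ho₁⟩ : ∃ o₁ : Over.mk s ⟶ Γ, o₁.left = x₁ := ⟨Over.homMk x₁ hs₁, rfl⟩
    obtain ⟨o₂, ho₂⟩ : ∃ o₂ : Over.mk s ⟶ Γ, o₂.left = x₂ := ⟨Over.homMk x₂ hs₂, rfl⟩
    have hx : o₁ ≫ i ≫ CartesianMonoidalCategory.fst T' hat.X = o₂ ≫ i ≫ CartesianMonoidalCategory.fst T' hat.X :=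
      Over.OverMorphism.ext (by simp only [Over.comp_left, ho₁, ho₂] at h12 ⊢; exact h12)
    have g₁ := (hΓ' _ _).mp ⟨o₁, rfl⟩
    have g₂ := (hΓ' _ _).mp ⟨o₂, rfl⟩
    have hyy := graphPoints_injective R A L hL p hat π hπ P hker h1 hsock T' ℒ hℒ s (o₁ ≫ i) (o₂ ≫ i)
      (by simpa only [Category.assoc] using hx) g₁ g₂
    have hoi : o₁ ≫ i = o₂ ≫ i := by
      apply CartesianMonoidalCategory.hom_ext
      · simpa only [Category.assoc] using hx
      · simpa only [Category.assoc] using hyy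
    have ho : o₁ = o₂ := (cancel_mono i).1 hoi
    rw [← ho₁, ← ho₂, ho]
  haveI : IsClosedImmersion (i ≫ CartesianMonoidalCategory.fst T' hat.X).left := socket_McW1 _ hinj
  -- (N3′) every infinitesimal neighbourhood factors, hence an isomorphism
  haveI : IsIso (i ≫ CartesianMonoidalCategory.fst T' hat.X).left :=
    Literature.AlgebraicGeometry.Morphisms.isIso_of_isClosedImmersion_of_forall_factor _
      (factor_infinitesimalNbhd_of_graph R A L hL hε hΘ p hH1 hat π hπ P hker h1 hrig hsock T' ℒ hℒ Γ i hΓ')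
  haveI : IsIso ((Over.forget S').map (i ≫ CartesianMonoidalCategory.fst T' hat.X)) := by
    change IsIso (i ≫ CartesianMonoidalCategory.fst T' hat.X).left
    infer_instance
  haveI : IsIso (i ≫ CartesianMonoidalCategory.fst T' hat.X) :=
    isIso_of_reflects_iso (i ≫ CartesianMonoidalCategory.fst T' hat.X) (Over.forget S')
  -- the section and the conclusion
  obtain ⟨σ, hσ⟩ : ∃ σ : T' ⟶ hat.X,
      σ = inv (i ≫ CartesianMonoidalCategory.fst T' hat.X) ≫ i ≫ CartesianMonoidalCategory.snd _ _ := ⟨_, rfl⟩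
  have hsec : inv (i ≫ CartesianMonoidalCategory.fst T' hat.X) ≫ i = CartesianMonoidalCategory.lift (𝟙 _) σ := by
    apply CartesianMonoidalCategory.hom_ext
    · rw [CartesianMonoidalCategory.lift_fst, Category.assoc, IsIso.inv_hom_id]
    · rw [CartesianMonoidalCategory.lift_snd, Category.assoc, hσ]
  -- the graph condition at a section `(1, s)` IS the universal-property clause for `g = s`
  have hlift : ∀ s : T' ⟶ hat.X, GC _ (CartesianMonoidalCategory.lift (𝟙 _) s) ↔
      Nonempty ((Scheme.Modules.pullback ((A.baseChange p).baseChangeToProd hat T'.hom s.left (Over.w s))).obj P ≅ ℒ.L) := by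
    intro s
    rw [hGC]
    have hφ : (A.baseChange p).baseChangeToProd hat T'.hom
          (CartesianMonoidalCategory.lift (𝟙 _) s ≫ CartesianMonoidalCategory.snd _ _).left
          (Over.w (CartesianMonoidalCategory.lift (𝟙 _) s ≫ CartesianMonoidalCategory.snd _ _)) =
        (A.baseChange p).baseChangeToProd hat T'.hom s.left (Over.w s) :=
      AbelianSchemeOver.baseChangeToProd_congr _ _ _ (by rw [CartesianMonoidalCategory.lift_snd]) _ _
    have e₁ := congrArg (fun φ => (Scheme.Modules.pullback φ).obj P) hφ
    have hw : ((A.baseChange p).X ◁ (CartesianMonoidalCategory.lift (𝟙 T') s ≫ CartesianMonoidalCategory.fst _ _)).left =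
        𝟙 _ := by
      rw [CartesianMonoidalCategory.lift_fst, MonoidalCategory.whiskerLeft_id, Over.id_left]
    have e₂ : (Scheme.Modules.pullback ((A.baseChange p).X ◁
          (CartesianMonoidalCategory.lift (𝟙 T') s ≫ CartesianMonoidalCategory.fst _ _)).left).obj ℒ.L ≅ ℒ.L :=
      eqToIso (congrArg (fun φ => (Scheme.Modules.pullback φ).obj ℒ.L) hw) ≪≫ (Scheme.Modules.pullbackId _).app ℒ.L
    exact ⟨fun ⟨φ⟩ => ⟨(eqToIso e₁).symm ≪≫ φ ≪≫ e₂⟩, fun ⟨ψ⟩ => ⟨eqToIso e₁ ≪≫ ψ ≪≫ e₂.symm⟩⟩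
  have hcσ : GC _ (CartesianMonoidalCategory.lift (𝟙 _) σ) := hsec ▸ (hΓ _ _).mp ⟨_, rfl⟩
  refine ⟨⟨σ.left, Over.w σ⟩, (hlift σ).mp hcσ, ?_⟩
  rintro ⟨g', hg'⟩ hψ
  obtain ⟨s', hs'⟩ : ∃ s' : T' ⟶ hat.X, s'.left = g' := ⟨Over.homMk g' hg', rfl⟩
  subst hs'
  have hc' : GC _ (CartesianMonoidalCategory.lift (𝟙 _) s') := (hlift s').mpr hψ
  obtain ⟨v, hv⟩ := (hΓ _ _).mpr hc'
  have hvp : v ≫ (i ≫ CartesianMonoidalCategory.fst T' hat.X) = 𝟙 _ := by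
    rw [← Category.assoc, hv, CartesianMonoidalCategory.lift_fst]
  have hv' : v = inv (i ≫ CartesianMonoidalCategory.fst T' hat.X) := by
    rw [← cancel_mono (i ≫ CartesianMonoidalCategory.fst T' hat.X), hvp, IsIso.inv_hom_id]
  have hs : s' = σ := by
    rw [← CartesianMonoidalCategory.lift_snd (𝟙 _) s', ← hv, hv', Category.assoc, hσ]
  exact Subtype.ext (congrArg (fun s => s.left) hs)

end Composition

/-! ## §4 THE HEAD — the (Mc) letter `stub_F3Mc` with `[Algebra ℚ R]` removed: universality over ALL `T → S′` -/

/-- **HEAD — UNIVERSALITY OF `(Â′ = A′⁄K(L′), 𝒫′)` OVER ALL `T → S′`, ANY CHARACTERISTIC** (= ★ `stub_F3Mc_holds` with `[Algebra ℚ R]` removed):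
(N0′) ★ `existsUnique_classify_of_affine_finiteType_of_isAffine` reduces to an affine finite-type base, settled by §3.  [cite: MumfordAV1970, §13 Theorem (p. 125)]
[cite: MumfordFogartyKirwan1994, Ch. 6 §2 (p. 121)] [cite: MilneAV2008, I §8 pp. 36–37] -/
theorem existsUnique_classify : ∀ (R : Type) [CommRing R] [IsNoetherianRing R] (A : AbelianSchemeOver (Spec (.of R)))
    (L : A.left.Modules) (hL : HasRank L 1)
    (_hε : CechPic.pullback A.unitSection (detClass (HasRank.isFiniteLocallyFree' hL)) = 1)
    (_hΘ : ∀ ⦃Ω : Type⦄ [Field Ω] [IsAlgClosed Ω] (s : Spec (.of Ω) ⟶ Spec (.of R)),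
      ∃ Θ : CartierDivisor (A.fibre s).toAbelianVariety.X.left, Θ.IsAmple ∧
        CechPic.pullback (X := (A.fibre s).toAbelianVariety.X.left) (pullback.fst A.X.hom s)
          (detClass (HasRank.isFiniteLocallyFree' hL)) = Θ.cechClass)
    {S' : Scheme.{0}} [IsAffine S'] (p : S' ⟶ Spec (.of R)) [IsFinite p] [Etale p] [Surjective p]
    (hH1 : ∀ (K₁ : Type) [Field K₁] (s : Spec (.of K₁) ⟶ S') {J : Type} [Finite J]
      (U : J → ((A.baseChange p).X ⊗ Over.mk s).left.Opens), (∀ i, IsAffineOpen (U i)) → iSup U = ⊤ →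
      Module.Finite K₁ (Literature.AlgebraicGeometry.Morphisms.CechH1 (X := ((A.baseChange p).X ⊗ Over.mk s).left)
        (Limits.pullback.snd (A.baseChange p).X.hom s) U) ∧
        Module.finrank K₁ (Literature.AlgebraicGeometry.Morphisms.CechH1 (X := ((A.baseChange p).X ⊗ Over.mk s).left)
          (Limits.pullback.snd (A.baseChange p).X.hom s) U) = ((A.baseChange p).fibre s).toAbelianVariety.dim)
    (hat : AbelianSchemeOver S') (π : (A.baseChange p).X ⟶ hat.X) [IsMonHom π]
    (_hπ : IsFinite π.left ∧ Etale π.left ∧ Surjective π.left)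
    (P : ((A.baseChange p).prodLeft hat).Modules)
    (_hker : ∀ (T : Over S') (u : T ⟶ (A.baseChange p).X),
      u ≫ π = 1 ↔ (A.baseChange p).MemKOfL ((Scheme.Modules.pullback (pullback.fst A.X.hom p)).obj L) u)
    (_h1 : HasRank P 1)
    (_hrig : Nonempty ((Scheme.Modules.pullback ((A.baseChange p).unitSlice hat)).obj P ≅ SheafOfModules.unit _))
    (_hsock : Nonempty ((Scheme.Modules.pullback ((A.baseChange p).X ◁ π).left).obj P ≅
      (A.baseChange p).mumfordBundle ((Scheme.Modules.pullback (pullback.fst A.X.hom p)).obj L))),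
    ∀ {T : Scheme.{0}} (f : T ⟶ S') (ℒ : (A.baseChange p).RigidifiedLineBundle f), ℒ.FibrewisePicZero →
      ∃! g : {g : T ⟶ hat.X.left // g ≫ hat.X.hom = f},
        Nonempty ((Scheme.Modules.pullback ((A.baseChange p).baseChangeToProd hat f g.1 g.2)).obj P ≅ ℒ.L) := by
  intro R _ _ A L hL hε hΘ S' _ p _ _ _ hH1 hat π _ hπ P hker h1 hrig hsock T f ℒ hℒ
  -- (N0′) affine finite type ⇒ all `T → S′` (★ `existsUnique_classify_of_affine_finiteType_of_isAffine`, Noetherian approximation)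
  haveI : IsLocallyNoetherian S' := LocallyOfFiniteType.isLocallyNoetherian p
  exact (A.baseChange p).existsUnique_classify_of_affine_finiteType_of_isAffine hat P h1 hrig
    (fun T' hT f' hfT ℒ' hℒ' => by
      haveI : IsAffine (Over.mk f').left := hT
      haveI : LocallyOfFiniteType (Over.mk f').hom := hfT
      exact existsUnique_classify_affineFiniteType R A L hL hε hΘ p hH1 hat π hπ P hker h1 hrig hsock (Over.mk f') ℒ' hℒ')
    f ℒ hℒ

end MumfordDual

end Literature.AlgebraicGeometry.AbelianSchemes

end
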